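import Summits.QuantumAdvantage.QuantumAdvantage.Theorems.CubicForrelationNearExactIsExactTenZCount
import Summits.QuantumAdvantage.QuantumAdvantage.Theorems.CubicForrelationNearExactIsExactTenPartner

/-!
# Crux `CubicForrelation.NearExactIsExact` (stmt-QuantumAdvantage-14043) — n = 12: duality of the two residuals of a type-E pair

Certificate seat `b2b-cforr-cert` (gen 13).  HONEST FRAMING: an exact identity (standard axioms) for the successor who attacks the level-5 ×
level-5 class left open by `window_twelve_structure`; finite-slice bookkeeping, NOT summit progress.

`tw_residual_duality`: if `W_g = 32·u'` and `W_f = 32·v'` (any Boolean `f, g` on 12 bits) then the Walsh transform of the residual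
`e_g = u' − 2(−1)^f` is `−64` times the other residual: `Σ_x e_g(x) (−1)^{x·z} = −64 · (v'(z) − 2(−1)^{g(z)})`.  (Walsh inversion
`tz_inversion` for `g`, and the definition of `W_f`.)  Consequently the two residuals have equal energy and each determines the other; for
a pair with `59/64 < Φ < 1` both are supported on hyperplanes with odd-kind wild points (`window_twelve_structure`).
-/

set_option linter.dupNamespace false -- D-0017: single-problem summit ⇒ `QuantumAdvantage.QuantumAdvantage` by design

noncomputable section

namespace Summit.QuantumAdvantage.QuantumAdvantage.Theorems.CubicForrelation.NearExactIsExact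

open Finset
open Literature.Computability.QuantumComplexity
open Literature.Computability.QuantumComplexity.BuzetChailloux (bxor)
open Literature.Computability.QuantumComplexity.DerivativeWalsh (W)

/-- **Residual duality.**  `W_g = 32u'`, `W_f = 32v'` ⇒ `Σ_x (u'(x) − 2(−1)^{f(x)})·(−1)^{x·z} = −64·(v'(z) − 2(−1)^{g(z)})`. [this work] -/
theorem tw_residual_duality (f g : (Fin (6 + 6) → Bool) → Bool) (u' v' : (Fin (6 + 6) → Bool) → ℤ)
    (hu' : ∀ x, W (fun y => signOf (g y)) x = (2 : ℝ) ^ 5 * (u' x : ℝ))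
    (hv' : ∀ x, W (fun y => signOf (f y)) x = (2 : ℝ) ^ 5 * (v' x : ℝ)) (z : Fin (6 + 6) → Bool) :
    ∑ x, ((u' x - 2 * sZ (f x) : ℤ) : ℝ) * twist x z = -64 * ((v' z - 2 * sZ (g z) : ℤ) : ℝ) := by
  have hinv := tz_inversion (fun y => signOf (g y)) z
  have e1 : ∀ x : Fin (6 + 6) → Bool, W (fun y => signOf (g y)) x * twist x z = 32 * ((u' x : ℝ) * twist x z) := fun x => by
    rw [hu' x]; ring
  rw [sum_congr rfl fun x _ => e1 x, ← mul_sum] at hinv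
  have hWf : W (fun y => signOf (f y)) z = ∑ x, signOf (f x) * twist x z := by
    simp only [W, twist_comm]
  have e2 : ∀ x : Fin (6 + 6) → Bool, ((u' x - 2 * sZ (f x) : ℤ) : ℝ) * twist x z =
      (u' x : ℝ) * twist x z - 2 * (signOf (f x) * twist x z) := fun x => by
    push_cast; rw [tp_sZ_cast]; ring
  rw [sum_congr rfl fun x _ => e2 x, sum_sub_distrib, ← mul_sum, ← hWf, hv' z]
  push_cast
  rw [tp_sZ_cast]
  have h12 : (2 : ℝ) ^ (6 + 6) = 32 * 128 := by norm_num
  rw [h12] at hinv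
  have hs : ∑ x, (u' x : ℝ) * twist x z = 128 * signOf (g z) := by linarith
  rw [hs]
  ring

end Summit.QuantumAdvantage.QuantumAdvantage.Theorems.CubicForrelation.NearExactIsExact

end
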